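import Mathlib

/-!
# T5HoweUniqueness — kernel witnesses for route/T5-CHECK-N3-p8.md v3 §7 (blind cell pub-hodge-repro2)

Two elementary steps of the re-derivation of route/T5-N3-route-2.md §N3.10 (local Howe-duality
UNIQUENESS, row T2 of sub-step N3), in kernel form. Nothing representation-theoretic is asserted:
the groups, the Weil representation and the dual pair stay in the prose; the kernel checks two
module / matrix identities.

1. THE UNIQUENESS READING of Mœglin–Vignéras–Waldspurger, LNM 1291, Ch. 5 Théorème I.6
   («Il existe un unique sous-espace V₂″ de V₂′, invariant par U₂′, tel que V₂′/V₂″ soit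
   irréductible») and of Ch. 3 Théorème principal 1) a) (an irreducible ϑ_{m′}(π)): a module with a
   UNIQUE coatom has all its simple quotients isomorphic — any two surjections onto simple modules
   have the same kernel (`ker_eq_of_unique_coatom`), the unique coatom is that kernel
   (`coatom_eq_ker`), and the two targets are isomorphic (`simple_quotients_equiv`). In §N3.10.3
   the module is V₂′ (S[π₁] ≅ V₁ ⊗ V₂′): every irreducible partner of π₁ is a quotient of V₂′, so
   there is at most one; for an irreducible module (§N3.10.4, ϑ_{m′}(π) irreducible) the unique
   coatom is ⊥ (`isCoatom_bot_of_isSimpleModule`) and the same conclusion follows.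

2. Δ-N3.10-a: on the printed model (1.4) of Mínguez, Ann. Sci. ÉNS (4) 41 (2008) —
   (σ_{n,m}(g, g′)Φ)(x) = Φ(g⁻¹ x g′) on functions on n × m matrices — the transpose
   (T Φ)(y) = Φ(yᵀ) intertwines the action of (g, g′) with the action of (θ g′, θ g) on functions
   on m × n matrices, where θ h = (hᵀ)⁻¹ (`transpose_intertwines`, g′ invertible); T is an
   involution up to the index swap (`T_T`), and the determinant twist ν = |det| of (1.4) obeys
   det (θ h) = (det h)⁻¹ (`det_theta`). Hence «ω_{n,m} and ω_{m,n} are the same representation of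
   the same pair with the factors named in the other order» holds exactly up to the automorphism
   θ × θ of the pair — which is all that uniqueness of the partner needs.
-/

namespace Summit.Ventures.HodgeRepro2.T5HoweUniqueness

section UniqueCoatom

variable {R M : Type*} [Ring R] [AddCommGroup M] [Module R M]

/-- A surjection onto a simple module has a coatom as its kernel (first isomorphism theorem and
`isSimpleModule_iff_isCoatom`). -/
theorem isCoatom_ker_of_surjective {S : Type*} [AddCommGroup S] [Module R S] [IsSimpleModule R S]
    (f : M →ₗ[R] S) (hf : Function.Surjective f) : IsCoatom (LinearMap.ker f) := by
  rw [← isSimpleModule_iff_isCoatom]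
  exact IsSimpleModule.congr (f.quotKerEquivOfSurjective hf)

/-- If `M` has a UNIQUE coatom, any two surjections of `M` onto simple modules have the same
kernel — MVW's «unique sous-espace V₂″ … tel que V₂′/V₂″ soit irréductible» read as uniqueness of
the irreducible quotient. -/
theorem ker_eq_of_unique_coatom (hN : ∃! N : Submodule R M, IsCoatom N)
    {S₁ S₂ : Type*} [AddCommGroup S₁] [Module R S₁] [AddCommGroup S₂] [Module R S₂]
    [IsSimpleModule R S₁] [IsSimpleModule R S₂]
    (f : M →ₗ[R] S₁) (g : M →ₗ[R] S₂) (hf : Function.Surjective f) (hg : Function.Surjective g) :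
    LinearMap.ker f = LinearMap.ker g :=
  hN.unique (isCoatom_ker_of_surjective f hf) (isCoatom_ker_of_surjective g hg)

/-- The unique coatom is the kernel of every surjection onto a simple module. -/
theorem coatom_eq_ker (hN : ∃! N : Submodule R M, IsCoatom N) {N : Submodule R M}
    (hN' : IsCoatom N) {S : Type*} [AddCommGroup S] [Module R S] [IsSimpleModule R S]
    (f : M →ₗ[R] S) (hf : Function.Surjective f) : N = LinearMap.ker f :=
  hN.unique hN' (isCoatom_ker_of_surjective f hf)

/-- If `M` has a UNIQUE coatom, all simple quotients of `M` are isomorphic: «at most one partner». -/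
theorem simple_quotients_equiv (hN : ∃! N : Submodule R M, IsCoatom N)
    {S₁ S₂ : Type*} [AddCommGroup S₁] [Module R S₁] [AddCommGroup S₂] [Module R S₂]
    [IsSimpleModule R S₁] [IsSimpleModule R S₂]
    (f : M →ₗ[R] S₁) (g : M →ₗ[R] S₂) (hf : Function.Surjective f) (hg : Function.Surjective g) :
    Nonempty (S₁ ≃ₗ[R] S₂) :=
  ⟨(f.quotKerEquivOfSurjective hf).symm.trans
    ((Submodule.quotEquivOfEq _ _ (ker_eq_of_unique_coatom hN f g hf hg)).trans
      (g.quotKerEquivOfSurjective hg))⟩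

/-- In a simple module `⊥` is a coatom. -/
theorem isCoatom_bot_of_isSimpleModule [IsSimpleModule R M] : IsCoatom (⊥ : Submodule R M) := by
  rw [← isSimpleModule_iff_isCoatom]
  exact IsSimpleModule.congr (Submodule.quotEquivOfEqBot ⊥ rfl)

/-- A simple module has `⊥` as its unique coatom (the case of an irreducible `ϑ_{m′}(π)`,
§N3.10.4). -/
theorem existsUnique_isCoatom_of_isSimpleModule [IsSimpleModule R M] :
    ∃! N : Submodule R M, IsCoatom N :=
  ⟨⊥, isCoatom_bot_of_isSimpleModule, fun N hN =>
    (IsSimpleOrder.eq_bot_or_eq_top N).resolve_right hN.1⟩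

/-- For a simple module every surjection onto a simple module is injective (its kernel is the
unique coatom `⊥`). -/
theorem ker_eq_bot_of_isSimpleModule [IsSimpleModule R M] {S : Type*} [AddCommGroup S]
    [Module R S] [IsSimpleModule R S] (f : M →ₗ[R] S) (hf : Function.Surjective f) :
    LinearMap.ker f = ⊥ :=
  (coatom_eq_ker existsUnique_isCoatom_of_isSimpleModule isCoatom_bot_of_isSimpleModule f hf).symm

end UniqueCoatom

section Transpose

open Matrix

variable {F : Type*} [Field F] {α : Type*} {n m : ℕ}

/-- The action of Mínguez (1.4) on functions on `n × m` matrices: `(act g g' Φ) x = Φ (g⁻¹ * x * g')`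
(`⁻¹` is `Matrix.inv`, the non-singular inverse). -/
noncomputable def act (g : Matrix (Fin n) (Fin n) F) (g' : Matrix (Fin m) (Fin m) F)
    (Φ : Matrix (Fin n) (Fin m) F → α) : Matrix (Fin n) (Fin m) F → α :=
  fun x => Φ (g⁻¹ * x * g')

/-- The transpose on functions: `(T Φ) y = Φ yᵀ`. -/
def T (Φ : Matrix (Fin n) (Fin m) F → α) : Matrix (Fin m) (Fin n) F → α :=
  fun y => Φ yᵀ

/-- `θ h = (hᵀ)⁻¹`, the transpose-inverse. -/
noncomputable def θ {k : ℕ} (h : Matrix (Fin k) (Fin k) F) : Matrix (Fin k) (Fin k) F := (hᵀ)⁻¹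

omit [Field F] in
/-- `T` is an involution up to the index swap. -/
theorem T_T (Φ : Matrix (Fin n) (Fin m) F → α) : T (T Φ) = Φ := by
  funext x
  simp [T]

/-- `(θ h)ᵀ = h⁻¹`. -/
theorem transpose_theta {k : ℕ} (h : Matrix (Fin k) (Fin k) F) : (θ h)ᵀ = h⁻¹ := by
  unfold θ
  rw [← Matrix.transpose_nonsing_inv, Matrix.transpose_transpose]

/-- `(θ h)⁻¹ = hᵀ` for invertible `h`. -/
theorem theta_inv {k : ℕ} (h : Matrix (Fin k) (Fin k) F) (hh : IsUnit h.det) : (θ h)⁻¹ = hᵀ := by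
  unfold θ
  exact Matrix.nonsing_inv_nonsing_inv _ (by rwa [Matrix.det_transpose])

/-- `((θ h)⁻¹)ᵀ = h` for invertible `h`. -/
theorem transpose_theta_inv {k : ℕ} (h : Matrix (Fin k) (Fin k) F) (hh : IsUnit h.det) :
    ((θ h)⁻¹)ᵀ = h := by
  rw [theta_inv h hh, Matrix.transpose_transpose]

/-- THE INTERTWINING IDENTITY (Δ-N3.10-a): `T ∘ act g g' = act (θ g') (θ g) ∘ T` — the printed
model `ω_{n,m}` and the model `ω_{m,n}` with the factors renamed are the same representation of the
pair exactly up to the automorphism `θ × θ`. -/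
theorem transpose_intertwines (g : Matrix (Fin n) (Fin n) F) (g' : Matrix (Fin m) (Fin m) F)
    (hg' : IsUnit g'.det) (Φ : Matrix (Fin n) (Fin m) F → α) :
    T (act g g' Φ) = act (θ g') (θ g) (T Φ) := by
  funext y
  simp only [T, act]
  rw [Matrix.transpose_mul, Matrix.transpose_mul, transpose_theta, transpose_theta_inv g' hg',
    Matrix.mul_assoc]

/-- The determinant twist `ν = |det|` of (1.4): `det (θ h) = (det h)⁻¹`. -/
theorem det_theta {k : ℕ} (h : Matrix (Fin k) (Fin k) F) : (θ h).det = h.det⁻¹ := by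
  unfold θ
  rw [Matrix.det_nonsing_inv, Matrix.det_transpose, Ring.inverse_eq_inv]

/-- `θ` is an involution: `θ (θ h) = h` for invertible `h`. -/
theorem theta_theta {k : ℕ} (h : Matrix (Fin k) (Fin k) F) (hh : IsUnit h.det) : θ (θ h) = h := by
  show ((θ h)ᵀ)⁻¹ = h
  rw [transpose_theta, Matrix.nonsing_inv_nonsing_inv _ hh]

end Transpose

end Summit.Ventures.HodgeRepro2.T5HoweUniqueness
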